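import Summits.HodgeConjecture.HodgeConjecture.Theorems.Ring2AbelianAllAndreSquareClassOfGroupLaw
import HarnessLib

/-!
# Ring 2 · sub-cell AbelianAll (ALL ABELIAN VARIETIES), André axis, part XXXVIII-d — TRANSPORT OF KLEIMAN IDENTITIES FROM AN
# ABELIAN VARIETY TO THE FIBRE: the class `Λ = m^*η₀ − a^*η₀ − b^*η₀` of a displayed group law restricts on `X_t × X_t`, along the
# chart `e : A ≅ X_t`, to EXACTLY the complexified Poincaré class `ℓ(θ)` of `(A, θ)`, `θ ⊗ 1 = e^* η_t`; and a fibrewise identity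
# `Σ_k c_k · θ^{j_k} ∪ [ℓ(θ)^{i_k}]_*((x ∪ θ^{r+1}) ∪ θ^{j_k}) = c₀ x` on `H^{b+1}(A)` transports to the same identity on `H^{b+1}(X_t)`
# for `λ = (E ≫ J_t)^*Λ`, `η_t = j_t^*η₀` (new coefficients, same `c₀`)

HONEST FRAMING (page 1, verbatim): **research route, not a corollary; conditional on HC_CM plus one named
minimal statement.** Cell line: research route conditional on HC_CM; not a corollary; Q11.4-sentence-2
already refuted in dim ≥ 3. This file does NOT prove `B(X)` for any new `X` and does NOT
touch `HC_CM`; the group law `m : 𝒳 ×_S 𝒳 ⟶ 𝒳` of the abelian scheme stays DISPLAYED (the carriers have no group law over `S`).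

Gen-30 file of the `ab-andre-2` seat (cell `pub-hodge-ring2`, sub-cell AbelianAll = ALL abelian varieties, not Weil-type-only).

## What this file proves (sorry-free, standard axioms only)

* §1 **`exists_poincareSquareClass_of_groupLaw`** — part XXXVII-h's construction with its identification RETAINED: for a compact
  pencil of abelian `(k+1)`-folds with `θ_N`, `θ₁, θ₂`, an algebraic top-weight `η₀` polarising `X_t` and a displayed group law `m`
  charted at `t` by `(A, e, E)`, the class `Λ := m^*η₀ − a^*η₀ − b^*η₀ ∈ N¹H²(𝒴)` has bi-weight `(1, 1)` AND
  `(e × e)^*(E ≫ J_t)^*Λ = ℓ(θ) ⊗ 1` for the rational class `θ` with `θ ⊗ 1 = (e ≫ j_t)^*η₀` (`ℓ(θ) = μ^*θ − pr₁^*θ − pr₂^*θ`).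
* §2 **`kleimanIdentity_transport`** — along an isomorphism `e : X' ≅ X` of smooth projective `n`-folds a Kleiman identity
  `Σ_k c_k · η'^{j_k} ∪ [λ'^{i_k}]_*((x' ∪ η'^{r+1}) ∪ η'^{j_k}) = c₀ x'` on `H^{b+1}(X')` for the pulled-back classes `λ' = (e × e)^*λ`,
  `η' = e^*η` implies the identity on `H^{b+1}(X)` for `λ, η` with coefficients `c_k / K` and the SAME `c₀` (part XXXVII-h's
  `exists_corrAction_map_iso`: `e^* ∘ [cl]_* = K · [(e × e)^* cl]_* ∘ e^*`, `K ≠ 0`).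
* §3 **`exists_kleimanCoefficients_of_groupLaw`** — for the pencil: a Kleiman identity proved for EVERY polarised abelian variety
  `(A, θ)` of dimension `k + 1` (a universally quantified hypothesis `hF`, in part XXXVIII-c's shape with `ℓ(θ) ⊗ 1` and `θ ⊗ 1`)
  yields the identity on `X_t` for `λ = (E ≫ J_t)^*Λ`, `η_t = j_t^*η₀` — the hypothesis `hfib` of part XXXVIII-c's
  `exists_blockClass_of_kleimanCoefficients`, with `Λ`, `E` INDEPENDENT of the block.

## Documentary interface — PRINT / LEAN / GAP

PRINT: [MumfordAV1970, §6 Cor. 3–4, §§8, 13] (the Poincaré / Mumford class `m^*θ − pr₁^*θ − pr₂^*θ`); Kleiman, Dix exposés, App. to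
§2, 2A8–2A11; Fulton Thm. 6.2 (a) (base change along an isomorphism). LEAN: displayed theorems, fact-free. GAP: none in this file (the
Kleiman identities themselves are the fibre files' business: `b = 0` part XXXVII-f, `b = 1` part XXXVIII-e).
-/

noncomputable section

set_option linter.dupNamespace false

namespace Summit.HodgeConjecture.HodgeConjecture.Ring2.AbelianAll

open CategoryTheory CategoryTheory.Limits AlgebraicGeometry MonoidalCategory CartesianMonoidalCategory
open Literature.AlgebraicGeometry Literature.AlgebraicGeometry.Motives
open Literature.AlgebraicGeometry.HodgeTheory
open Literature.AlgebraicTopology.SingularHomology (singularCohomology cupProduct cupProduct_map cupProduct_one one_cupProduct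
  cupProduct_assoc cupProduct_gradedComm_holds)
open Literature.AlgebraicTopology.CharacteristicClasses (cupPow cupPow_succ map_cupPow cupPow_smul)
open Summit.HodgeConjecture.CorCM.Model
open scoped MonObj

/-! ## §1 The class `Λ = m^* η₀ − a^* η₀ − b^* η₀` restricts to the Poincaré class `ℓ(θ) ⊗ 1` exactly -/

section GroupLaw

variable {𝒳 S : SchemeOver ℂ} {k : ℕ} {f : 𝒳 ⟶ S}

/-- `𝒴` — the fibre square `𝒳 ×_S 𝒳` (display notation for the tree's `familyPullback f f`). -/
local notation3 (prettyPrint := false) "𝒴[" f "]" => familyPullback f f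
/-- `𝐚` — the first projection `𝒳 ×_S 𝒳 ⟶ 𝒳`. -/
local notation3 (prettyPrint := false) "𝐚[" f "]" => familyPullback.fst f f
/-- `𝐛` — the second projection `𝒳 ×_S 𝒳 ⟶ 𝒳` (the pencil structure of the square is `𝐛 ≫ f`). -/
local notation3 (prettyPrint := false) "𝐛[" f "]" => familyPullback.snd f f
/-- `hY⟦hf⟧` — the square is a smooth projective `(2d+1)`-fold (part XXXVI-c). -/
local notation3 (prettyPrint := false) "hY⟦" hf "⟧" =>
  IsCompactAbelianPencil.isSmoothProjective_total (isCompactAbelianPencil_square hf rfl)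

/-- **THE CLASS `Λ` OF A DISPLAYED GROUP LAW RESTRICTS TO THE POINCARÉ CLASS EXACTLY.** Part XXXVII-h's `exists_squareClass_of_groupLaw`
with the identification retained: `Λ := m^*η₀ − a^*η₀ − b^*η₀` is algebraic, `(θ₁θ₂)^*Λ = N²Λ`, `θ₁^*Λ = NΛ`, and for the chart
`(A, e, E)` of the hypothesis and the rational class `θ` with `θ ⊗ 1 = (e ≫ j_t)^*η₀`: `(e × e)^*(E ≫ J_t)^*Λ = ℓ(θ) ⊗ 1`.
[cite: MumfordAV1970, §6 Cor. 3–4 and §13] [cite: Kleiman1968AlgebraicCycles, Thm. 2A9] [cite: Fulton1998, Thm. 6.2 (a)] -/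
theorem exists_poincareSquareClass_of_groupLaw (hf : IsCompactAbelianPencil f (k + 1)) (t : ComplexPoints S) (ν : 𝒳 ⟶ 𝒳)
    (hν : ν ≫ f = f) {N : ℕ} (hN : 2 ≤ N)
    (hθ : ∀ s : ComplexPoints S, ∃ (νs : fiberOver f s ⟶ fiberOver f s) (A : AbelianVariety ℂ) (e : A.X ≅ fiberOver f s),
      νs ≫ fiberι f s = fiberι f s ≫ ν ∧ e.hom ≫ νs = (N • 𝟙 A).hom.hom.hom ≫ e.hom)
    {θ₁ θ₂ : 𝒴[f] ⟶ 𝒴[f]} (h1a : θ₁ ≫ 𝐚[f] = 𝐚[f] ≫ ν) (h1b : θ₁ ≫ 𝐛[f] = 𝐛[f])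
    (h2a : θ₂ ≫ 𝐚[f] = 𝐚[f]) (h2b : θ₂ ≫ 𝐛[f] = 𝐛[f] ≫ ν)
    {η₀ : complexBetti 𝒳 2} (hη₀alg : η₀ ∈ algebraicClasses 𝒳 1) (hη₀ : complexBetti.map ν 2 η₀ = ((N : ℂ) ^ 2) • η₀)
    (hη₀pol : IsPolarizationClass (k + 1) (fiberOver f t) (complexBetti.map (fiberι f t) 2 η₀))
    (mS : 𝒴[f] ⟶ 𝒳) (hmν : (θ₁ ≫ θ₂) ≫ mS = mS ≫ ν)
    (hchart : ∃ (νt : fiberOver f t ⟶ fiberOver f t) (A : AbelianVariety ℂ) (e : A.X ≅ fiberOver f t)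
      (E : fiberOver f t ⊗ fiberOver f t ≅ fiberOver (𝐛[f] ≫ f) t),
      νt ≫ fiberι f t = fiberι f t ≫ ν ∧ e.hom ≫ νt = (N • 𝟙 A).hom.hom.hom ≫ e.hom ∧
      E.hom ≫ fiberι (𝐛[f] ≫ f) t ≫ 𝐚[f] = fst _ _ ≫ fiberι f t ∧ E.hom ≫ fiberι (𝐛[f] ≫ f) t ≫ 𝐛[f] = snd _ _ ≫ fiberι f t ∧
      (tensorIso e e).hom ≫ E.hom ≫ fiberι (𝐛[f] ≫ f) t ≫ mS = μ[A.X] ≫ e.hom ≫ fiberι f t) :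
    ∃ Λ : complexBetti 𝒴[f] 2, Λ ∈ algebraicClasses 𝒴[f] 1 ∧
      complexBetti.map (θ₁ ≫ θ₂) 2 Λ = ((N : ℂ) ^ 2) • Λ ∧ complexBetti.map θ₁ 2 Λ = (N : ℂ) • Λ ∧
      ∃ (A : AbelianVariety ℂ) (e : A.X ≅ fiberOver f t) (E : fiberOver f t ⊗ fiberOver f t ≅ fiberOver (𝐛[f] ≫ f) t)
        (θ : bettiCohomology A.X 2),
        E.hom ≫ fiberι (𝐛[f] ≫ f) t ≫ 𝐚[f] = fst _ _ ≫ fiberι f t ∧ E.hom ≫ fiberι (𝐛[f] ≫ f) t ≫ 𝐛[f] = snd _ _ ≫ fiberι f t ∧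
        A.dim = k + 1 ∧ ofRatClass (ComplexPoints A.X) 2 θ = complexBetti.map (e.hom ≫ fiberι f t) 2 η₀ ∧
        complexBetti.map (tensorIso e e).hom 2 (complexBetti.map (E.hom ≫ fiberι (𝐛[f] ≫ f) t) 2 Λ) =
          ofRatClass (ComplexPoints (A.X ⊗ A.X)) 2
            (BettiUniverse.pull μ[A.X] 2 θ - BettiUniverse.pull (fst A.X A.X) 2 θ - BettiUniverse.pull (snd A.X A.X) 2 θ) := by
  haveI : IsSeparated S.hom := hf.isSmoothProjective_base.isProjectiveOver.isProper.toIsSeparated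
  have h𝒳 := hf.isSmoothProjective_total
  have hY := hY⟦hf⟧
  have hg := isCompactAbelianPencil_square hf rfl
  have hXt := hf.isSmoothProjective_fiberOver t
  obtain ⟨νt, A, e, E, hνt, he, hEa, hEb, hm⟩ := hchart
  have hdim : A.dim = k + 1 := Andre1996.compactPencil_dim_eq_of_iso hf e
  have hA : IsSmoothProjective (k + 1) A.X := by rw [← hdim]; exact AbelianVariety.isSmoothProjective_holds (A := A)
  have hθ₁g : θ₁ ≫ (𝐛[f] ≫ f) = 𝐛[f] ≫ f := by rw [← Category.assoc, h1b]
  have hθg : (θ₁ ≫ θ₂) ≫ (𝐛[f] ≫ f) = 𝐛[f] ≫ f := by rw [Category.assoc, squareEndo_comp_eq hν h2b, hθ₁g]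
  have h12a : (θ₁ ≫ θ₂) ≫ 𝐚[f] = 𝐚[f] ≫ ν := by rw [Category.assoc, h2a, h1a]
  have h12b : (θ₁ ≫ θ₂) ≫ 𝐛[f] = 𝐛[f] ≫ ν := by rw [Category.assoc, h2b, ← Category.assoc, h1b]
  have hsqchart := exists_square_chart ν hν N hθ h1a h1b h2a h2b
  -- the class
  set Λ : complexBetti 𝒴[f] 2 := complexBetti.map mS 2 η₀ - complexBetti.map 𝐚[f] 2 η₀ - complexBetti.map 𝐛[f] 2 η₀ with hΛ
  -- algebraic
  have hΛalg : Λ ∈ algebraicClasses 𝒴[f] 1 := by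
    refine Submodule.sub_mem _ (Submodule.sub_mem _ ?_ ?_) ?_
    · exact map_mem_algebraicClasses_of_isAlgebraicCorrespondence hY h𝒳 (isAlgebraicCorrespondence_map hY h𝒳 mS (by omega)) hη₀alg
    · exact map_mem_algebraicClasses_of_isAlgebraicCorrespondence hY h𝒳 (isAlgebraicCorrespondence_map hY h𝒳 𝐚[f] (by omega)) hη₀alg
    · exact map_mem_algebraicClasses_of_isAlgebraicCorrespondence hY h𝒳 (isAlgebraicCorrespondence_map hY h𝒳 𝐛[f] (by omega)) hη₀alg
  -- top weight
  have hΛtop : complexBetti.map (θ₁ ≫ θ₂) 2 Λ = ((N : ℂ) ^ 2) • Λ := by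
    rw [hΛ, map_sub, map_sub, ← complexBetti.map_comp_apply', ← complexBetti.map_comp_apply', ← complexBetti.map_comp_apply',
      hmν, h12a, h12b, complexBetti.map_comp_apply', complexBetti.map_comp_apply', complexBetti.map_comp_apply', hη₀,
      map_smul, map_smul, map_smul, smul_sub, smul_sub]
  -- the restriction to `A × A` is the Poincaré class of `ηA = (e ≫ j_t)^* η₀ = θ ⊗ 1`
  have hρΛ : complexBetti.map (tensorIso e e).hom 2 (complexBetti.map (E.hom ≫ fiberι (𝐛[f] ≫ f) t) 2 Λ) =
      complexBetti.map μ[A.X] 2 (complexBetti.map (e.hom ≫ fiberι f t) 2 η₀) -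
        complexBetti.map (fst A.X A.X) 2 (complexBetti.map (e.hom ≫ fiberι f t) 2 η₀) -
        complexBetti.map (snd A.X A.X) 2 (complexBetti.map (e.hom ≫ fiberι f t) 2 η₀) := by
    rw [hΛ, map_sub, map_sub, map_sub, map_sub]
    simp only [← complexBetti.map_comp_apply', Category.assoc]
    rw [hm, hEa, hEb, ← Category.assoc (tensorIso e e).hom (fst _ _), ← Category.assoc (tensorIso e e).hom (snd _ _), tensorIso_hom,
      tensorHom_fst, tensorHom_snd, Category.assoc, Category.assoc]
  have hηApol : IsPolarizationClass (k + 1) A.X (complexBetti.map (e.hom ≫ fiberι f t) 2 η₀) := by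
    rw [complexBetti.map_comp_apply']
    exact IsPolarizationClass.map_of_iso hXt hA e hη₀pol
  obtain ⟨θ, hθη⟩ := (isRationalClass_iff_mem_range_ofRatClass _).1 hηApol.isRationalClass
  have hℓ' : ofRatClass (ComplexPoints (A.X ⊗ A.X)) 2
      (BettiUniverse.pull μ[A.X] 2 θ - BettiUniverse.pull (fst A.X A.X) 2 θ - BettiUniverse.pull (snd A.X A.X) 2 θ) =
      complexBetti.map (tensorIso e e).hom 2 (complexBetti.map (E.hom ≫ fiberι (𝐛[f] ≫ f) t) 2 Λ) := by
    rw [hρΛ, map_sub, map_sub, ofRatClass_pull, ofRatClass_pull, ofRatClass_pull, hθη]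
  -- `θ₁^* Λ = N Λ`: `D = θ₁^*Λ − NΛ` is of top weight and restricts to `([N] × 1)^* ℓ − N ℓ = 0` on `A × A`
  have hΛ1 : complexBetti.map θ₁ 2 Λ = (N : ℂ) • Λ := by
    obtain ⟨θ1t, hθ1t⟩ := exists_fiberEndo_restrict θ₁ hθ₁g t
    have c1 := squareEndo_fst_chart t ν h1a h1b E hEa hEb νt hνt θ1t hθ1t
    -- `(e × e) ≫ (ν_t × 1) = ([N] × 1) ≫ (e × e)`
    have l1 : ((tensorIso e e).hom ≫ (νt ▷ fiberOver f t)) ≫ fst _ _ = fst _ _ ≫ (N • 𝟙 A).hom.hom.hom ≫ e.hom := by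
      rw [Category.assoc, whiskerRight_fst, tensorIso_hom, tensorHom_fst_assoc, he]
    have l2 : ((tensorIso e e).hom ≫ (νt ▷ fiberOver f t)) ≫ snd _ _ = snd _ _ ≫ e.hom := by
      rw [Category.assoc, whiskerRight_snd, tensorIso_hom, tensorHom_snd]
    have r1 : (((N • 𝟙 A).hom.hom.hom ▷ A.X) ≫ (tensorIso e e).hom) ≫ fst _ _ = fst _ _ ≫ (N • 𝟙 A).hom.hom.hom ≫ e.hom := by
      rw [Category.assoc, tensorIso_hom, tensorHom_fst, whiskerRight_fst_assoc]
    have r2 : (((N • 𝟙 A).hom.hom.hom ▷ A.X) ≫ (tensorIso e e).hom) ≫ snd _ _ = snd _ _ ≫ e.hom := by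
      rw [Category.assoc, tensorIso_hom, tensorHom_snd, whiskerRight_snd_assoc]
    have c2 : (tensorIso e e).hom ≫ (νt ▷ fiberOver f t) = ((N • 𝟙 A).hom.hom.hom ▷ A.X) ≫ (tensorIso e e).hom :=
      CartesianMonoidalCategory.hom_ext _ _ (l1.trans r1.symm) (l2.trans r2.symm)
    set D : complexBetti 𝒴[f] (0 + 2) := complexBetti.map θ₁ 2 Λ - (N : ℂ) • Λ with hD
    have hDtop : complexBetti.map (θ₁ ≫ θ₂) (0 + 2) D = ((N : ℂ) ^ (0 + 2)) • D := by
      have e1 : complexBetti.map (θ₁ ≫ θ₂) 2 (complexBetti.map θ₁ 2 Λ) = ((N : ℂ) ^ 2) • complexBetti.map θ₁ 2 Λ := by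
        rw [← complexBetti.map_comp_apply', show (θ₁ ≫ θ₂) ≫ θ₁ = θ₁ ≫ (θ₁ ≫ θ₂) by
          rw [Category.assoc, ← squareEndo_comm ν h1a h1b h2a h2b], complexBetti.map_comp_apply', hΛtop, map_smul]
      change complexBetti.map (θ₁ ≫ θ₂) 2 (complexBetti.map θ₁ 2 Λ - (N : ℂ) • Λ) = ((N : ℂ) ^ 2) • (complexBetti.map θ₁ 2 Λ - (N : ℂ) • Λ)
      rw [map_sub, map_smul, e1, hΛtop, ← smul_comm ((N : ℂ) ^ 2) (N : ℂ) Λ, ← smul_sub]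
    have t1 : complexBetti.map (E.hom ≫ fiberι (𝐛[f] ≫ f) t) 2 (complexBetti.map θ₁ 2 Λ) =
        complexBetti.map (νt ▷ fiberOver f t) 2 (complexBetti.map (E.hom ≫ fiberι (𝐛[f] ≫ f) t) 2 Λ) := by
      rw [← complexBetti.map_comp_apply', ← complexBetti.map_comp_apply', Category.assoc, ← hθ1t, ← Category.assoc, c1, Category.assoc]
    have t2 : ∀ w : complexBetti (fiberOver f t ⊗ fiberOver f t) 2,
        complexBetti.map (tensorIso e e).hom 2 (complexBetti.map (νt ▷ fiberOver f t) 2 w) =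
          complexBetti.map ((N • 𝟙 A).hom.hom.hom ▷ A.X) 2 (complexBetti.map (tensorIso e e).hom 2 w) := by
      intro w
      rw [← complexBetti.map_comp_apply', ← complexBetti.map_comp_apply', c2]
    have hρD : complexBetti.map (tensorIso e e).hom 2 (complexBetti.map (E.hom ≫ fiberι (𝐛[f] ≫ f) t) 2 D) = 0 := by
      change complexBetti.map (tensorIso e e).hom 2 (complexBetti.map (E.hom ≫ fiberι (𝐛[f] ≫ f) t) 2
        (complexBetti.map θ₁ 2 Λ - (N : ℂ) • Λ)) = 0
      rw [map_sub, map_sub, map_smul, map_smul, t1, t2, ← hℓ', map_nsmul_whiskerRight_poincareClass A N θ, sub_self]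
    have hJD : complexBetti.map (fiberι (𝐛[f] ≫ f) t) (0 + 2) D = 0 := by
      have h1 : complexBetti.map (E.hom ≫ fiberι (𝐛[f] ≫ f) t) 2 D = 0 := by
        have h := congrArg (complexBetti.map (tensorIso e e).inv 2) hρD
        rwa [← complexBetti.map_comp_apply', Iso.inv_hom_id, complexBetti.map_id, ModuleCat.id_apply, map_zero] at h
      have h := congrArg (complexBetti.map E.inv 2) h1
      rwa [complexBetti.map_comp_apply', ← complexBetti.map_comp_apply' E.inv E.hom, E.inv_hom_id, complexBetti.map_id,
        ModuleCat.id_apply, map_zero] at h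
    have hD0 : D = 0 := eq_zero_of_topWeight_of_map_fiberι_eq_zero hg t (θ₁ ≫ θ₂) hθg hN hsqchart (k := 0) (by omega) hDtop hJD
    exact sub_eq_zero.1 hD0
  exact ⟨Λ, hΛalg, hΛtop, hΛ1, A, e, E, θ, hEa, hEb, hdim, hθη, hℓ'.symm⟩

end GroupLaw

/-! ## §2 Kleiman identities transport along an isomorphism of the fibre -/

section Transport

variable {X X' : SchemeOver ℂ} {n : ℕ}

/-- **A KLEIMAN IDENTITY TRANSPORTS ALONG AN ISOMORPHISM `e : X' ≅ X`.** If on `X'`, for the pulled-back classes `λ' = (e × e)^*λ` and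
`η' = e^*η`, `Σ_k c_k · η'^{j_k} ∪ [λ'^{i_k}]_*((x' ∪ η'^{r+1}) ∪ η'^{j_k}) = c₀ x'` for every `x' ∈ H^{b+1}(X')`, then on `X`, for `λ, η`,
the same identity holds with coefficients `c_k K⁻¹` and the same `c₀` (`K ≠ 0` the scalar of part XXXVII-h's `exists_corrAction_map_iso`:
`e^* [cl]_* c = K · [(e × e)^* cl]_* (e^* c)`; `e^*` is injective and a ring map). [cite: Fulton1998, Thm. 6.2 (a) and Prop. 1.7]
[cite: VoisinHodgeII2003, (10.7)] [cite: Kleiman1968AlgebraicCycles, App. to §2, 2A9–2A11] -/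
theorem kleimanIdentity_transport (hX : IsSmoothProjective n X) (hX' : IsSmoothProjective n X') (e : X' ≅ X)
    (lam : complexBetti (X ⊗ X) 2) (ηX : complexBetti X 2) {b r n' : ℕ} (i j : Fin n' → ℕ)
    (h₁ : ∀ k, 2 * j k + i k = b + 1) (h₂ : ∀ k, b + 1 + 2 * (r + 1) + 2 * j k + 2 * i k = i k + 2 * n)
    (c : Fin n' → ℂ) (c₀ : ℂ)
    (hX'id : ∀ x' : complexBetti X' (b + 1),
      ∑ k, c k • cupProduct (h₁ k) (cupPow ℂ (complexBetti.map e.hom 2 ηX) (j k))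
        (corrAction complexOrientationFamily hX' hX' (h₂ k) (cupPow ℂ (complexBetti.map (tensorIso e e).hom 2 lam) (i k))
          (cupProduct (rfl : b + 1 + 2 * (r + 1) + 2 * j k = b + 1 + 2 * (r + 1) + 2 * j k)
            (cupProduct (rfl : b + 1 + 2 * (r + 1) = b + 1 + 2 * (r + 1)) x'
              (cupPow ℂ (complexBetti.map e.hom 2 ηX) (r + 1)))
            (cupPow ℂ (complexBetti.map e.hom 2 ηX) (j k)))) = c₀ • x') :
    ∃ c' : Fin n' → ℂ, ∀ x : complexBetti X (b + 1),
      ∑ k, c' k • cupProduct (h₁ k) (cupPow ℂ ηX (j k))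
        (corrAction complexOrientationFamily hX hX (h₂ k) (cupPow ℂ lam (i k))
          (cupProduct (rfl : b + 1 + 2 * (r + 1) + 2 * j k = b + 1 + 2 * (r + 1) + 2 * j k)
            (cupProduct (rfl : b + 1 + 2 * (r + 1) = b + 1 + 2 * (r + 1)) x (cupPow ℂ ηX (r + 1)))
            (cupPow ℂ ηX (j k)))) = c₀ • x := by
  obtain ⟨K, hK0, hK⟩ := exists_corrAction_map_iso hX hX' e
  have hjinj : Function.Injective (complexBetti.map e.hom (b + 1)) := by
    intro y y' hyy'
    have h := congrArg (complexBetti.map e.inv (b + 1)) hyy'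
    rwa [← complexBetti.map_comp_apply', ← complexBetti.map_comp_apply', e.inv_hom_id, complexBetti.map_id,
      ModuleCat.id_apply, ModuleCat.id_apply] at h
  have hpow : ∀ l : ℕ, complexBetti.map e.hom (2 * l) (cupPow ℂ ηX l) = cupPow ℂ (complexBetti.map e.hom 2 ηX) l :=
    fun l ↦ map_cupPow ℂ _ ηX l
  have hpow2 : ∀ l : ℕ, complexBetti.map (tensorIso e e).hom (2 * l) (cupPow ℂ lam l) = cupPow ℂ (complexBetti.map (tensorIso e e).hom 2 lam) l :=
    fun l ↦ map_cupPow ℂ _ lam l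
  refine ⟨fun k ↦ c k * K⁻¹, fun x ↦ hjinj ?_⟩
  rw [map_sum, map_smul, ← hX'id (complexBetti.map e.hom (b + 1) x)]
  refine Finset.sum_congr rfl fun k _ ↦ ?_
  rw [map_smul, complexBetti.map_cupProduct, hpow, hK (h₂ k), hpow2, complexBetti.map_cupProduct, complexBetti.map_cupProduct, hpow, hpow,
    map_smul, smul_smul, mul_assoc, inv_mul_cancel₀ hK0, mul_one]

end Transport

/-! ## §3 Kleiman coefficients on `X_t` from a universal fibre identity and a displayed group law -/

section Pencil

variable {𝒳 S : SchemeOver ℂ} {k : ℕ} {f : 𝒳 ⟶ S}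

/-- `𝒴` — the fibre square `𝒳 ×_S 𝒳` (display notation for the tree's `familyPullback f f`). -/
local notation3 (prettyPrint := false) "𝒴[" f "]" => familyPullback f f
/-- `𝐚` — the first projection `𝒳 ×_S 𝒳 ⟶ 𝒳`. -/
local notation3 (prettyPrint := false) "𝐚[" f "]" => familyPullback.fst f f
/-- `𝐛` — the second projection `𝒳 ×_S 𝒳 ⟶ 𝒳` (the pencil structure of the square is `𝐛 ≫ f`). -/
local notation3 (prettyPrint := false) "𝐛[" f "]" => familyPullback.snd f f

/-- **KLEIMAN COEFFICIENTS ON THE FIBRE FROM A UNIVERSAL FIBRE IDENTITY.** Let the data of `exists_poincareSquareClass_of_groupLaw` be given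
together with its OUTPUT `(Λ, A, e, E, θ)`. If a Kleiman identity with exponents `i_k + 2 j_k = b + 1` holds for the polarised abelian
variety `(A, θ ⊗ 1)` with `ℓ(θ) ⊗ 1` — in part XXXVIII-c's shape — then the corresponding identity holds on `X_t` for `λ = (E ≫ J_t)^*Λ`
and `η_t = j_t^*η₀` (§2), i.e. the hypothesis `hfib` of part XXXVIII-c's `exists_blockClass_of_kleimanCoefficients`.
[cite: Kleiman1968AlgebraicCycles, App. to §2, 2A9–2A11] [cite: MumfordAV1970, §6 Cor. 3–4] [cite: Fulton1998, Thm. 6.2 (a)] -/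
theorem exists_kleimanCoefficients_of_poincareSquareClass (hf : IsCompactAbelianPencil f (k + 1)) (t : ComplexPoints S)
    {η₀ : complexBetti 𝒳 2} {Λ : complexBetti 𝒴[f] 2} {A : AbelianVariety ℂ} (hA : IsSmoothProjective (k + 1) A.X)
    (e : A.X ≅ fiberOver f t) (E : fiberOver f t ⊗ fiberOver f t ≅ fiberOver (𝐛[f] ≫ f) t) {θ : bettiCohomology A.X 2}
    (hθη : ofRatClass (ComplexPoints A.X) 2 θ = complexBetti.map (e.hom ≫ fiberι f t) 2 η₀)
    (hΛℓ : complexBetti.map (tensorIso e e).hom 2 (complexBetti.map (E.hom ≫ fiberι (𝐛[f] ≫ f) t) 2 Λ) =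
      ofRatClass (ComplexPoints (A.X ⊗ A.X)) 2
        (BettiUniverse.pull μ[A.X] 2 θ - BettiUniverse.pull (fst A.X A.X) 2 θ - BettiUniverse.pull (snd A.X A.X) 2 θ))
    {b r n' : ℕ} (hbr : b + r + 1 = k) (i j : Fin n' → ℕ) (hij : ∀ l, i l + 2 * j l = b + 1) (c : Fin n' → ℂ) (c₀ : ℂ)
    (hAid : ∀ x' : complexBetti A.X (b + 1),
      ∑ l, c l • cupProduct (show 2 * j l + i l = b + 1 by have := hij l; omega) (cupPow ℂ (ofRatClass (ComplexPoints A.X) 2 θ) (j l))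
        (corrAction complexOrientationFamily hA hA (show b + 1 + 2 * (r + 1) + 2 * j l + 2 * i l = i l + 2 * (k + 1) by have := hij l; omega)
          (cupPow ℂ (ofRatClass (ComplexPoints (A.X ⊗ A.X)) 2
            (BettiUniverse.pull μ[A.X] 2 θ - BettiUniverse.pull (fst A.X A.X) 2 θ - BettiUniverse.pull (snd A.X A.X) 2 θ)) (i l))
          (cupProduct (rfl : b + 1 + 2 * (r + 1) + 2 * j l = b + 1 + 2 * (r + 1) + 2 * j l)
            (cupProduct (rfl : b + 1 + 2 * (r + 1) = b + 1 + 2 * (r + 1)) x'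
              (cupPow ℂ (ofRatClass (ComplexPoints A.X) 2 θ) (r + 1)))
            (cupPow ℂ (ofRatClass (ComplexPoints A.X) 2 θ) (j l)))) = c₀ • x') :
    ∃ c' : Fin n' → ℂ, ∀ x : complexBetti (fiberOver f t) (b + 1),
      ∑ l, c' l • cupProduct (show 2 * j l + i l = b + 1 by have := hij l; omega)
        (cupPow ℂ (complexBetti.map (fiberι f t) 2 η₀) (j l))
        (corrAction complexOrientationFamily (hf.isSmoothProjective_fiberOver t) (hf.isSmoothProjective_fiberOver t)
          (show b + 1 + 2 * (r + 1) + 2 * j l + 2 * i l = i l + 2 * (k + 1) by have := hij l; omega)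
          (cupPow ℂ (complexBetti.map (E.hom ≫ fiberι (𝐛[f] ≫ f) t) 2 Λ) (i l))
          (cupProduct (rfl : b + 1 + 2 * (r + 1) + 2 * j l = b + 1 + 2 * (r + 1) + 2 * j l)
            (cupProduct (rfl : b + 1 + 2 * (r + 1) = b + 1 + 2 * (r + 1)) x
              (cupPow ℂ (complexBetti.map (fiberι f t) 2 η₀) (r + 1)))
            (cupPow ℂ (complexBetti.map (fiberι f t) 2 η₀) (j l)))) = c₀ • x := by
  refine kleimanIdentity_transport (hf.isSmoothProjective_fiberOver t) hA e _ _ i j _ _ c c₀ fun x' ↦ ?_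
  rw [← complexBetti.map_comp_apply', ← hθη, hΛℓ]
  exact hAid x'

end Pencil

end Summit.HodgeConjecture.HodgeConjecture.Ring2.AbelianAll

end
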